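import Literature.NumberTheory.EllipticCurves.AbelianVarietyBridge
import HarnessLib

/-!
# Elliptic curves as abelian varieties: bridge data for all four `Hom`-groups of a pair

`Literature.NumberTheory.EllipticCurves.AbelianVarietyBridge` records the identification of a
pair of elliptic curves `E, E'` over a perfect field `K` (Weierstrass equations `W, W'`,
`Δ ≠ 0`) with a pair of one-dimensional abelian varieties `A, A'` over `K` as a hypothesis
structure `WeierstrassCurve.AbelianVarietyBridge W W'` — `Γ_K`-equivariant additive
isomorphisms `e : A(K̄) ≅ E(K̄)`, `e' : A'(K̄) ≅ E'(K̄)` under which every non-zero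
`K`-homomorphism `A → A'` acts on points as an isogeny `E → E'` over `K` — and the named facts
`nonempty_abelianVarietyBridge W W'` (existence for elliptic `W, W'`) and
`nonempty_abelianVarietyBridge_symm W W'` (the same with the compatibility also for `A' → A`),
both by the construction: the smooth plane cubic of `W` with base point `O = [0, 1, 0]` and the
chord–tangent law is an abelian variety of dimension one (Silverman, *AEC*, III.3.1(c), III.3.6;
Shatz 1986, §2), with `K̄`-points `E(K̄)` (III.1–III.2) and the coordinatewise `Γ_K`-action
(I.2), and a homomorphism between two such cubic `K`-group schemes is a morphism with `O ↦ O`,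
i.e. an isogeny in Silverman's sense — `[0]` or finite surjective (III.4, by II.2.3), a group
homomorphism (III.4.8) with finite kernel (III.4.9), given by rational functions of the
Weierstrass coordinates (II.1–II.2) and defined over `K`.

Tate's argument for the `Hom` form of the Tate conjecture ("Theorem 4 applied to `A₁ × A₂`",
Faltings 1983, §5, Korollar 1; Milne, *Abelian Varieties*, Ch. IV, Cor. 2.6) runs through the
endomorphism algebra of the product,
`End(A × A') = End(A) ⊕ Hom(A, A') ⊕ Hom(A', A) ⊕ End(A')`, so transporting its conclusion to
the curves needs the identification for **all four** summands: besides `A → A'` and `A' → A`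
also `A → A` (non-zero endomorphisms of `A` are isogenies `E → E` over `K`, i.e. elements of
`End_K(E)`) and `A' → A'`. This file records that strengthening, by the same construction and
the same argument (which is insensitive to which two of the cubics `E, E'` are source and
target):

* `WeierstrassCurve.AbelianVarietyBridgeFull W W'` — a structure extending
  `AbelianVarietyBridge W W'` by the three further compatibilities `exists_isogeny_symm`
  (`A' → A`), `exists_isogeny_end` (`A → A`), `exists_isogeny_end'` (`A' → A'`);
* `WeierstrassCurve.nonempty_abelianVarietyBridgeFull W W'` (named fact): for `K` perfect and
  `W, W'` elliptic, `Nonempty (AbelianVarietyBridgeFull W W')`; unfolding lemma `_iff`;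
* proved: `nonempty_abelianVarietyBridge_symm_of_full`, `nonempty_abelianVarietyBridge_of_full`
  (the two earlier facts follow by forgetting compatibilities), and the `AddMonoidHom` forms
  `AbelianVarietyBridgeFull.exists_isogeny_symm_comp`, `exists_isogeny_end_comp`,
  `exists_isogeny_end'_comp` of the new compatibilities (as `AbelianVarietyBridge.exists_isogeny_comp`).

Consumer: `Literature.AlgebraicGeometry.Motives.FaltingsECSubspacesHomOfAbelianVarietyProofs`
(Faltings' subspace statement for `E × E'`, `Literature.AlgebraicGeometry.Motives.stable_subspace_prod_eq_range_pair`, hence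
Korollar 1 for `(E, E')`, from Tate's lattice lemma for the abelian surface `A × A'`).

## What is *not* asserted

As in the parent file: no uniqueness of `A`, no `dim A = 1`, and not the converse "every
`K`-isogeny / `K`-endomorphism of the curves is induced by a homomorphism of `A, A'`"; `K` is
perfect (Silverman's standing hypothesis, Ch. I).

## References

* [SilvermanAEC2009] J. H. Silverman, *The Arithmetic of Elliptic Curves*, 2nd ed., GTM 106,
  Springer 2009: I.2, II.2.3, III.1, III.2.3, III.3.1(c), III.3.6, III.4 (Definition, p. 66),
  III.4.8, III.4.9.
* [Shatz1986GroupSchemes] S. S. Shatz, *Group schemes, formal groups, and p-divisible groups*,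
  in Cornell–Silverman (eds.), *Arithmetic Geometry*, Springer 1986, §2, pp. 33–34.
* [MilneAV2008] J. S. Milne, *Abelian Varieties*, course notes v2.00 (2008), Ch. IV, Cor. 2.6
  (the block decomposition of `End(A × B) ⊗ ℚ_ℓ`).
* [Faltings1983Endlichkeit] G. Faltings, Invent. Math. 73 (1983), §5, Korollar 1.

## Design choices

As in `AbelianVarietyBridge`: `noncomputable section`, `namespace WeierstrassCurve`, named
universe `u`; the compatibilities are stated pointwise (`ψ (e P) = e (f P)`); `f ≠ 0` refers to
the `Preadditive` structure of `Literature.AbelianVariety K`; hypothesis instances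
`[PerfectField K] [W.IsElliptic] [W'.IsElliptic]` are quantified in the body of the fact. The
new structure *extends* the old one, so `B.toAbelianVarietyBridge` feeds every existing consumer.
-/

noncomputable section

open CategoryTheory

universe u

namespace WeierstrassCurve

variable {K : Type u} [Field K] (W W' : WeierstrassCurve K)

/-- **Bridge data for a pair of Weierstrass curves, with all four `Hom`-compatibilities.**
Bridge data `(A, A', e, e', …)` as in `AbelianVarietyBridge W W'` (abelian varieties `A, A'`
over `K`, `Γ_K`-equivariant additive isomorphisms `e : A(K̄) ≅ E(K̄)`, `e' : A'(K̄) ≅ E'(K̄)`,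
every non-zero `f : A ⟶ A'` an isogeny `E → E'` on points) such that moreover every non-zero
`K`-homomorphism `A' ⟶ A`, `A ⟶ A`, `A' ⟶ A'` acts on geometric points, after transport along
`e, e'`, as an isogeny `E' → E`, `E → E`, `E' → E'` defined over `K`. For elliptic `W, W'` over
a perfect field such data are furnished by the smooth plane cubics of `W, W'` (see
`nonempty_abelianVarietyBridgeFull`). Silverman, *AEC*, III.3.1(c), III.3.6, III.4.8, III.4.9;
Shatz 1986, §2. [folklore] -/
structure AbelianVarietyBridgeFull extends AbelianVarietyBridge W W' where
  /-- Every non-zero `K`-homomorphism `f : A' ⟶ A` is, on geometric points and after transport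
  along `e', e`, an isogeny `W' → W` defined over `K`. -/
  exists_isogeny_symm : ∀ f : A' ⟶ A, f ≠ 0 →
    ∃ ψ : Isogeny W' W, ∀ P : A'.geomPoints, ψ (e' P) = e (Literature.AlgebraicGeometry.Motives.AbelianVariety.Hom.geomPointsMap f P)
  /-- Every non-zero `K`-endomorphism `f : A ⟶ A` is, on geometric points and after transport
  along `e`, an isogeny `W → W` defined over `K` (an element of `End_K(E)`). -/
  exists_isogeny_end : ∀ f : A ⟶ A, f ≠ 0 →
    ∃ ψ : Isogeny W W, ∀ P : A.geomPoints, ψ (e P) = e (Literature.AlgebraicGeometry.Motives.AbelianVariety.Hom.geomPointsMap f P)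
  /-- Every non-zero `K`-endomorphism `f : A' ⟶ A'` is, on geometric points and after transport
  along `e'`, an isogeny `W' → W'` defined over `K` (an element of `End_K(E')`). -/
  exists_isogeny_end' : ∀ f : A' ⟶ A', f ≠ 0 →
    ∃ ψ : Isogeny W' W', ∀ P : A'.geomPoints, ψ (e' P) = e' (Literature.AlgebraicGeometry.Motives.AbelianVariety.Hom.geomPointsMap f P)

namespace AbelianVarietyBridgeFull

variable {W W'} (B : AbelianVarietyBridgeFull W W')

/-- The compatibility `exists_isogeny_symm` as an identity of additive maps:
`ψ ∘ e' = e ∘ f(K̄)` for some isogeny `ψ : E' → E`, for every non-zero `f : A' ⟶ A`.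
Silverman, *AEC*, III.4.8. [folklore] -/
theorem exists_isogeny_symm_comp (f : B.A' ⟶ B.A) (hf : f ≠ 0) :
    ∃ ψ : Isogeny W' W,
      ψ.toAddMonoidHom.comp (B.e' : B.A'.geomPoints →+ W'.geomPoints) =
        (B.e : B.A.geomPoints →+ W.geomPoints).comp (Literature.AlgebraicGeometry.Motives.AbelianVariety.Hom.geomPointsMap f) := by
  obtain ⟨ψ, hψ⟩ := B.exists_isogeny_symm f hf
  exact ⟨ψ, AddMonoidHom.ext fun P ↦ by simpa using hψ P⟩

/-- The compatibility `exists_isogeny_end` as an identity of additive maps: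
`ψ ∘ e = e ∘ f(K̄)` for some isogeny `ψ : E → E`, for every non-zero `f : A ⟶ A`.
Silverman, *AEC*, III.4.8. [folklore] -/
theorem exists_isogeny_end_comp (f : B.A ⟶ B.A) (hf : f ≠ 0) :
    ∃ ψ : Isogeny W W,
      ψ.toAddMonoidHom.comp (B.e : B.A.geomPoints →+ W.geomPoints) =
        (B.e : B.A.geomPoints →+ W.geomPoints).comp (Literature.AlgebraicGeometry.Motives.AbelianVariety.Hom.geomPointsMap f) := by
  obtain ⟨ψ, hψ⟩ := B.exists_isogeny_end f hf
  exact ⟨ψ, AddMonoidHom.ext fun P ↦ by simpa using hψ P⟩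

/-- The compatibility `exists_isogeny_end'` as an identity of additive maps:
`ψ ∘ e' = e' ∘ f(K̄)` for some isogeny `ψ : E' → E'`, for every non-zero `f : A' ⟶ A'`.
Silverman, *AEC*, III.4.8. [folklore] -/
theorem exists_isogeny_end'_comp (f : B.A' ⟶ B.A') (hf : f ≠ 0) :
    ∃ ψ : Isogeny W' W',
      ψ.toAddMonoidHom.comp (B.e' : B.A'.geomPoints →+ W'.geomPoints) =
        (B.e' : B.A'.geomPoints →+ W'.geomPoints).comp (Literature.AlgebraicGeometry.Motives.AbelianVariety.Hom.geomPointsMap f) := by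
  obtain ⟨ψ, hψ⟩ := B.exists_isogeny_end' f hf
  exact ⟨ψ, AddMonoidHom.ext fun P ↦ by simpa using hψ P⟩

end AbelianVarietyBridgeFull

/-- **Elliptic curves are abelian varieties of dimension one — bridge data for all four
`Hom`-groups of the pair** (named fact). Let `K` be a perfect field and `W, W'` elliptic curves
over `K` (`Δ ≠ 0`). Then there are bridge data `B : AbelianVarietyBridgeFull W W'`: abelian
varieties `A, A'` over `K` with `Γ_K`-equivariant additive isomorphisms `A(K̄) ≅ E(K̄)`,
`A'(K̄) ≅ E'(K̄)` under which every non-zero `K`-homomorphism `A → A'`, `A' → A`, `A → A`,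
`A' → A'` is, on geometric points, an isogeny `E → E'`, `E' → E`, `E → E`, `E' → E'` defined
over `K`. Namely `A, A'` are the smooth plane cubics defined by `W, W'` with base point
`O = [0, 1, 0]` and the chord–tangent law: a smooth Weierstrass cubic is an elliptic curve over
`K` (AEC III.3.1(c)) whose group law is given by morphisms (III.3.6), hence "a group scheme …
which is also a projective variety (of dimension 1) … an elliptic curve or abelian variety of
dimension 1" (Shatz 1986, §2, pp. 33–34); its `K̄`-points are the affine points over `K̄` and `O`
(III.1–III.2) with the coordinatewise `Γ_K`-action (I.2); and a homomorphism of `K`-group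
schemes between any two of these cubics (in either order, or from one to itself) is a morphism
with `O ↦ O`, i.e. an isogeny in Silverman's sense, which is `[0]` or finite surjective (III.4,
by II.2.3) — and a non-zero homomorphism is not `[0]` on `K̄`-points, the cubics being
geometrically reduced — a group homomorphism (III.4.8) with finite kernel (III.4.9), given by
rational functions in the Weierstrass coordinates off a finite set (II.1–II.2) and commuting with
`Γ_K`, being defined over `K`. This is the argument recorded for `A → A'` in
`nonempty_abelianVarietyBridge` and for `A' → A` in `nonempty_abelianVarietyBridge_symm`, applied
verbatim to the remaining two `Hom`-groups. The perfectness of `K` is Silverman's standing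
hypothesis (Ch. I, "K a perfect field").
[cite: SilvermanAEC2009, III.3.1(c), III.3.6, III.4.8, III.4.9] -/
def nonempty_abelianVarietyBridgeFull : Prop :=
  ∀ [PerfectField K] [W.IsElliptic] [W'.IsElliptic], Nonempty (AbelianVarietyBridgeFull W W')

/-- Unfolding `nonempty_abelianVarietyBridgeFull`. [folklore] -/
theorem nonempty_abelianVarietyBridgeFull_iff :
    nonempty_abelianVarietyBridgeFull W W' ↔
      ∀ [PerfectField K] [W.IsElliptic] [W'.IsElliptic],
        Nonempty (AbelianVarietyBridgeFull W W') :=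
  Iff.rfl

/-- The full bridge fact implies the symmetric one of `AbelianVarietyBridge`
(`nonempty_abelianVarietyBridge_symm`: forget the two `End`-compatibilities). [folklore] -/
theorem nonempty_abelianVarietyBridge_symm_of_full (h : nonempty_abelianVarietyBridgeFull W W') :
    nonempty_abelianVarietyBridge_symm W W' := by
  intro _ _ _
  obtain ⟨B⟩ := h
  exact ⟨B.toAbelianVarietyBridge, B.exists_isogeny_symm⟩

/-- The full bridge fact implies the one-directional one (`nonempty_abelianVarietyBridge`).
[folklore] -/
theorem nonempty_abelianVarietyBridge_of_full (h : nonempty_abelianVarietyBridgeFull W W') :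
    nonempty_abelianVarietyBridge W W' :=
  nonempty_abelianVarietyBridge_of_symm W W' (nonempty_abelianVarietyBridge_symm_of_full W W' h)

end WeierstrassCurve
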